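import Summits.CriticalPhenomena.SAWScalingLimit.Theses.SAWTwistedSelfEnergy
import HarnessLib

/-!
# Strategist sketch (crux stmt-CriticalPhenomena-1881, bet route SAWTwistedSelfEnergy): census signatures

Typed forms of the two statements the census names (nothing here is filed as an item):

* `Z2BoundaryArcMass` — the ℤ² analogue of Duminil-Copin–Smirnov's boundary-sum bound (arXiv:1007.0575
  Lemma 2 / bridge bound `B_T^{x_c} ≤ 1`): the `x_c`-mass of self-avoiding arcs of `Ω_δ` from a fixed
  vertex `a` to ANY discrete-boundary vertex is bounded by an absolute constant.  On the hexagonal lattice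
  this is a consequence of the exact vertex relation; on ℤ² it is what the bet route's twisted-resolvent
  engine would have to deliver at FINITE volume to touch the tightness programme at all (it implies the
  ceiling critical bubble `CeilingBubbleBound`, finding F-B of crux stmt-1878 — the certified common input of
  every uniform pocket engine).  Census §Transfer T2.
* `NoReturnTight` — the no-(ε,ℓ)-return strengthening of the crux (= crux ∧ simple subsequential limits);
  census §Strengthen S_A.
-/

noncomputable section

open MeasureTheory Filter Topology Set Metric
open scoped ENNReal NNReal unitInterval
open Literature.Probability.RandomPlanarGeometry Literature.Probability.LatticeModels

namespace Summit.CriticalPhenomena.SAWScalingLimit.Cruxes.EventualTight.StrategistB1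

/-- **ℤ² boundary arc-mass bound** (census T2; candidate SUPPORT statement for the bet route, not filed):
there is an absolute `C < ∞` such that for every bounded open `Ω`, mesh `δ > 0` and vertex `a` of `Ω_δ`,
`Σ_{z ∈ ∂Ω_δ} Z_Ω(a → z) ≤ C`, where `Z_Ω(a → z) = SAW.weight Ω δ a z univ` is the `x_c`-mass of
self-avoiding arcs of `Ω_δ` from `a` to `z`.  Hex analogue: DCS12 Lemma 2 (positive boundary coefficients)
⇒ bridge bound.  Implies `CriticalBubbleBound`-type statements for boundary-adjacent pairs. -/
def Z2BoundaryArcMass : Prop :=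
  ∃ C : ℝ≥0∞, C ≠ ⊤ ∧ ∀ (Ω : Set ℂ) (δ : ℝ) (a : Site 2), Bornology.IsBounded Ω → 0 < δ →
    a ∈ meshDomain Ω δ →
      ∑' z : meshBoundary Ω δ, SAW.weight Ω δ a (z : Site 2) Set.univ ≤ C

/-- A curve has an **`(ε, ℓ)`-return**: points `γ s`, `γ u` (`s < u`) within `ε` of each other with an
excursion of size `≥ ℓ` in between. -/
def HasReturn (γ : Curve ℂ) (ε ℓ : ℝ) : Prop :=
  ∃ s t u : unitInterval, s < t ∧ t < u ∧ dist (γ s) (γ u) ≤ ε ∧ ℓ ≤ dist (γ s) (γ t)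

/-- **No-return tightness** (census S_A; STRONGER than the crux: it is the crux plus simplicity of every
subsequential limit): for every Dobrushin domain, endpoint approximation, scale `ℓ > 0` and `θ > 0` there is
`ε > 0` such that for all small `δ` the critical SAW polyline has an `(ε, ℓ)`-return with probability `≤ θ`.
`NoReturnTight → EventualTight` is a pigeonhole + the tree's tortuosity compactness
(`CurveClass.isCompact_closure_image_mk_of_tortuosity_le`); the converse fails (non-simple limits). -/
def NoReturnTight : Prop :=
  ∀ (D : DobrushinDomain) (a b : ℝ → Site 2), SAW.IsEndpointApprox D a b →
    ∀ ℓ : ℝ, 0 < ℓ → ∀ θ : ℝ, 0 < θ → ∃ ε : ℝ, 0 < ε ∧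
      ∀ᶠ δ in 𝓝[>] (0 : ℝ),
        SAW.law D.carrier δ (a δ) (b δ)
          {γ | HasReturn ⟨γ.walk.toCurve (meshPoint δ)⟩ ε ℓ} ≤ ENNReal.ofReal θ

/-- Sanity: the no-return event is monotone in `ε` (smaller `ε`, smaller event). [folklore] -/
theorem hasReturn_mono {γ : Curve ℂ} {ε ε' ℓ : ℝ} (h : ε ≤ ε') (hγ : HasReturn γ ε ℓ) :
    HasReturn γ ε' ℓ := by
  obtain ⟨s, t, u, hst, htu, hsu, hl⟩ := hγ
  exact ⟨s, t, u, hst, htu, hsu.trans h, hl⟩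

end Summit.CriticalPhenomena.SAWScalingLimit.Cruxes.EventualTight.StrategistB1

end
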